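import Summits.QuantumFields.YangMills.Theorems.UnitScaleTiltHalvingP1FlatPillarPackage
import HarnessLib

/-!
# Route `UnitScaleTilt`, crux K1 child «MinimiserStabilityRegPr» (stmt-QuantumFields-19200), registered stub `stub_halvingStep` (H), the P1 end of the door —
# **`package_rows_of_core` WITH A BALL-GUARDED TRACELESSNESS ROW** (LEAD ★w5-19200 g4 RULING L-1 (R4); census #45 §2c): the unguarded binder
# `hCtr : ∀ Y, (∀ b, tr Y b = 0) → ∀ i, tr (C Y i) = 0` of ✓`HalvingP1FlatPillarPackage.package_rows_of_core` (★w3-19200 g4, p621071) ∕ ✓`HalvingChartP1FlatRows.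
# package_rows_of_P1FlatPillarAt` ∕ ✓`HalvingChartP1Display.package_rows_of_P1disp_su2` (★w7-19200 g0) is replaced by the guarded
# `hCtrB : ∀ Y, (∀ b, w₁(b)‖Y b‖ < Rt) → (∀ b, tr Y b = 0) → ∀ i, tr (C Y i) = 0` + `B₁ε₀ < Rt` — the shape its only landed supplier has
# (✓p620806 `ChartDoubleBarAbelian.trace_chartRemainderFlat_eq_zero_weightedBall₀`, guarded by the weighted ball), used ONCE, at the pillar's `A` (`w₁‖A‖ ≤ B₁ε₀ < Rt`)

Cell `ym3-torus` (HUMAN RULING D-0037, YM ladder rung R3 — continuum SU(2) YM₃ on the torus is a RUNG, not the Clay problem), width seat `ym-ust-19200-w1` gen 7.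
`--supports stmt-QuantumFields-19200 --as helper`; def-free, 0 sorry, standard axioms; a NEW file (the three landed theorems stay byte-identical; the door
★w3-19200 g4's `halvingStep_of_pillars` swaps one name).  Counts toward nothing by itself.

WHAT IS PROVED: ★ `package_rows_of_core_ball` — ✓`package_rows_of_core`'s statement VERBATIM except `(hCtr …)` ↦ `{Rt} (hCtrB …) (hδRt : B₁ * ε₀ < Rt)`; proof =
✓`hP1_of_P1FlatPillarAt` ∘ ✓`p1FlatPillarAt_of_core` ∘ ✓`package_rows_of_P1disp` ∘ ✓`trace_chartPreimage_eq_zero` with the guard discharged by the pillar's own (152)♭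
sup row (conjunct 4 of `hP1`).
HONEST SCOPE: bookkeeping; NOT a claim about the stub, the crux, the rung or a mass gap.

References: T. Bałaban, CMP **102** (1985) 277–309 [Balaban1985Variational] ((152)–(156) pp.301–302, (160) p.303); CMP **99** (1985) 75–102 [Balaban1985RegularSpaces] (Thm 2 p.83).
-/

set_option autoImplicit false

noncomputable section

open scoped BigOperators Matrix.Norms.L2Operator

namespace Summit.QuantumFields.YangMills.Theorems.HalvingP1FlatPillarPackageBall

open Literature.MathematicalPhysics.QuantumFieldTheory.Balaban1983to89
open Literature.MathematicalPhysics.QuantumFieldTheory.Balaban1983to89.T3ContinuumYM3Torus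
open Literature.MathematicalPhysics.QuantumFieldTheory.Balaban1983to89.T3UnitLawDensityEML (ℰp)
open Literature.MathematicalPhysics.QuantumFieldTheory.Balaban1983to89.T3ConstrainedMinimiser (fibre)
open Complex (I)
open B5Eq117TorusCarriers (Mk)
open B5Eq118OneStroke (iterBlockOf)
open B5Prop12FieldsLattice (distSite)
open B6SectADomainsV1 (Domains)
open B6SectAOperatorsV1 (BondIdx SiteIdx RE dsE)
open B7Prop1Explicit (expUnit)
open B8Eq140Level (SideTouches)
open B8Thm2SetupTorus (pullDom)
open B10Eq27TorusAxialLog (transl unitsField toUField)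
open LatticeFieldCalculus (laplace diverg siteAvgIter)
open FlatCubeOpsText (IsLevWeight)
open FlatOpsLettersAssembly (flatH)
open FlatCubeSequenceAligned (cubeSeqMT3)
open HalvingP1FlatPillar (DP1Clause P1FlatPillarAt hP1_of_P1FlatPillarAt)
open HalvingP1FlatPillarRows (p1FlatPillarAt_of_core)
open HalvingChartP1Display (package_rows_of_P1disp trace_chartPreimage_eq_zero)
open Summit.QuantumFields.YangMills.Theorems.Prop8ChartDoubleBar (chartLogFlat)

variable {F : T3Family} {n K : ℕ}

/-- ★ **`package_rows_of_core` WITH THE BALL-GUARDED TRACELESSNESS ROW** — ✓`HalvingP1FlatPillarPackage.package_rows_of_core` VERBATIM except that the remainder map's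
tracelessness is asked only on the weighted ball `w₁‖Y‖ < Rt` (`hCtrB`, the shape of ✓`trace_chartRemainderFlat_eq_zero_weightedBall₀`) together with `B₁ε₀ < Rt`; it is used once,
at the pillar's `A`, whose (152)♭ sup row puts it in that ball. [cite: Balaban1985Variational, (152)-(156) pp.301-302, (160) p.303; Balaban1985RegularSpaces, Thm 2 p.83] -/
theorem package_rows_of_core_ball (hnK : n < K) (x : Site (F.P K) 0) (ρ S M : ℕ) (hM : 1 ≤ M) {R' : ℕ} (hRS : R' * M ≤ S)
    (hRM : 2 * (F.P K).L ≤ R' * M + 1) {ε₀ ε₁ B₁ : ℝ} (hε₁ : 0 ≤ ε₁) (hε₀ : 0 < ε₀)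
    (hreg₁ : 12 * ((ρ : ℝ) + (M : ℝ)) * ε₁ ≤ 1)
    (hreg₀ : 16 * 3800 * ((((F.P K).d + 2) * (F.P K).L : ℕ) : ℝ) ^ 2 * (F.L : ℝ) * ((B₁ + 1) * ε₀) ≤ 1)
    {V : GaugeField (F.P n) 0 (Matrix.specialUnitaryGroup (Fin 2) ℂ)} {U : GaugeField (F.P K) 0 (Matrix.specialUnitaryGroup (Fin 2) ℂ)}
    (hU : U ∈ fibre F ℰp n K hnK.le V) (hV : PlaqSmall ε₁ V)
    (core : ∃ (u : GaugeTransf (F.P K) 0 (Matrix.unitaryGroup (Fin 2) ℂ)) (A : PBond (F.P K) 0 → Matrix (Fin 2) (Fin 2) ℂ),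
      DP1Clause F n K (cubeSeqMT3 F n K x ρ S M hM) x U u ∧
      (∀ b : PBond (F.P K) 0, IsSelfAdjoint (A b)) ∧ (∀ b : PBond (F.P K) 0, Matrix.trace (A b) = 0) ∧
      (∀ j, 1 ≤ j → j ≤ K - n → ∀ (z : B7Prop1Explicit.Site (F.P K).d) (μ : Fin (F.P K).d),
        SideTouches (pullDom (fun i => {y : Site (F.P K) 0 | (cubeSeqMT3 F n K x ρ S M hM).InOm i y}) j) z μ →
        (Unitary.toUnits (u (transl 0 z)))⁻¹ * unitsField (toUField U) ⟨transl 0 z, μ⟩ * Unitary.toUnits (u ((transl 0 z).shift μ)) =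
          expUnit (I • ((((F.L : ℝ)⁻¹) ^ (K - n)) • A ⟨transl 0 z, μ⟩))) ∧
      (∀ w : ℕ → PBond (F.P K) 0 → ℝ, IsLevWeight F n K (cubeSeqMT3 F n K x ρ S M hM) w →
        (∀ b : PBond (F.P K) 0, w 1 b * ‖A b‖ ≤ B₁ * ε₀) ∧
        (∀ (b : PBond (F.P K) 0) (ν : Fin (F.P K).d), w 2 b * (F.L : ℝ) ^ (K - n) * ‖A ⟨b.src.shift ν, b.dir⟩ - A b‖ ≤ B₁ * ε₀)) ∧
      (∃ μ : SiteIdx (cubeSeqMT3 F n K x ρ S M hM) → Matrix (Fin 2) (Fin 2) ℂ, ∀ s : Site (F.P K) 0,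
        laplace ((F.L : ℝ) ^ (K - n)) (diverg ((F.L : ℝ) ^ (K - n)) A) s =
          ∑ i : SiteIdx (cubeSeqMT3 F n K x ρ S M hM), siteAvgIter (i.1.1 : ℕ) (Pi.single s (1 : ℝ)) i.1.2 • μ i))
    {w : ℕ → PBond (F.P K) 0 → ℝ} (hw : IsLevWeight F n K (cubeSeqMT3 F n K x ρ S M hM) w)
    (C : (PBond (F.P K) 0 → Matrix (Fin 2) (Fin 2) ℂ) → (BondIdx (cubeSeqMT3 F n K x ρ S M hM) → Matrix (Fin 2) (Fin 2) ℂ)) {B_H B_H' C₂' R : ℝ}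
    (hH : ∀ (X : BondIdx (cubeSeqMT3 F n K x ρ S M hM) → Matrix (Fin 2) (Fin 2) ℂ) (t : ℝ), (∀ i, ‖X i‖ ≤ t) →
      ∀ b, w 1 b * ‖∑ c, flatH F n K (cubeSeqMT3 F n K x ρ S M hM) (Pi.single c 1) b • X c‖ ≤ B_H * t)
    (hH' : ∀ (X : BondIdx (cubeSeqMT3 F n K x ρ S M hM) → Matrix (Fin 2) (Fin 2) ℂ) (t : ℝ), (∀ i, ‖X i‖ ≤ t) →
      ∀ (b : PBond (F.P K) 0) (ν : Fin (F.P K).d),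
        w 2 b * (F.L : ℝ) ^ (K - n) *
          ‖(∑ c, flatH F n K (cubeSeqMT3 F n K x ρ S M hM) (Pi.single c 1) ⟨b.src.shift ν, b.dir⟩ • X c) -
            ∑ c, flatH F n K (cubeSeqMT3 F n K x ρ S M hM) (Pi.single c 1) b • X c‖ ≤ B_H' * t)
    (hCq : ∀ (Y : PBond (F.P K) 0 → Matrix (Fin 2) (Fin 2) ℂ) (r : ℝ), r < R → (∀ b, w 1 b * ‖Y b‖ ≤ r) → ∀ i, ‖C Y i‖ ≤ C₂' * r ^ 2)
    {Rt : ℝ} (hCtrB : ∀ (Y : PBond (F.P K) 0 → Matrix (Fin 2) (Fin 2) ℂ), (∀ b, w 1 b * ‖Y b‖ < Rt) → (∀ b, Matrix.trace (Y b) = 0) → ∀ i, Matrix.trace (C Y i) = 0)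
    (hδR : B₁ * ε₀ < R) (hδRt : B₁ * ε₀ < Rt) :
    ∃ (u : GaugeTransf (F.P K) 0 (Matrix.unitaryGroup (Fin 2) ℂ)) (A : PBond (F.P K) 0 → Matrix (Fin 2) (Fin 2) ℂ),
      ((∀ b : PBond (F.P K) 0, IsSelfAdjoint (A b)) ∧
        (∀ (z : B7Prop1Explicit.Site (F.P K).d) (μ : Fin (F.P K).d),
          SideTouches (pullDom (fun j => if K - n ≤ j then ({x} : Set (Site (F.P K) 0)) else (∅ : Set (Site (F.P K) 0))) (K - n)) z μ →
          (Unitary.toUnits (u (transl 0 z)))⁻¹ * unitsField (toUField U) ⟨transl 0 z, μ⟩ * Unitary.toUnits (u ((transl 0 z).shift μ)) =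
            expUnit (I • ((((F.L : ℝ)⁻¹) ^ (K - n)) • A ⟨transl 0 z, μ⟩)))) ∧
      (∀ b, Matrix.trace ((A + fun b => ∑ c, flatH F n K (cubeSeqMT3 F n K x ρ S M hM) (Pi.single c 1) b • C A c) b) = 0) ∧
      (∀ φ : Matrix (Fin 2) (Fin 2) ℂ →ₗ[ℝ] ℝ,
        RE (cubeSeqMT3 F n K x ρ S M hM) ((F.L : ℝ) ^ (K - n)) (dsE ((F.L : ℝ) ^ (K - n))
          (WithLp.toLp 2 (fun b => φ ((A + fun b => ∑ c, flatH F n K (cubeSeqMT3 F n K x ρ S M hM) (Pi.single c 1) b • C A c) b)))) = 0) ∧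
      (∀ b, w 1 b * ‖(A + fun b => ∑ c, flatH F n K (cubeSeqMT3 F n K x ρ S M hM) (Pi.single c 1) b • C A c) b‖ ≤ B₁ * ε₀ + B_H * (C₂' * (B₁ * ε₀) ^ 2)) ∧
      (∀ (b : PBond (F.P K) 0) (ν : Fin (F.P K).d),
        w 2 b * (F.L : ℝ) ^ (K - n) *
          ‖(A + fun b => ∑ c, flatH F n K (cubeSeqMT3 F n K x ρ S M hM) (Pi.single c 1) b • C A c) ⟨b.src.shift ν, b.dir⟩ -
            (A + fun b => ∑ c, flatH F n K (cubeSeqMT3 F n K x ρ S M hM) (Pi.single c 1) b • C A c) b‖ ≤ B₁ * ε₀ + B_H' * (C₂' * (B₁ * ε₀) ^ 2)) ∧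
      (∀ c : BondIdx (cubeSeqMT3 F n K x ρ S M hM), (c.1.1 : ℕ) = K - n →
        c.1.2.src ∈ (cubeSeqMT3 F n K x ρ S M hM).Om (c.1.1 : ℕ) → c.1.2.tgt ∈ (cubeSeqMT3 F n K x ρ S M hM).Om (c.1.1 : ℕ) →
        ‖chartLogFlat (((F.L : ℝ)⁻¹) ^ (K - n)) (cubeSeqMT3 F n K x ρ S M hM) A c‖ ≤
          6 * ε₁ * (distSite (Mk (F.P K) (c.1.1 : ℕ)) c.1.2.src (iterBlockOf (c.1.1 : ℕ) x) + 1)) ∧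
      DP1Clause F n K (cubeSeqMT3 F n K x ρ S M hM) x U u := by
  obtain ⟨u, A, h6, hnear, hdp1⟩ := hP1_of_P1FlatPillarAt F n K hnK x ρ S M hM
    (p1FlatPillarAt_of_core hnK x ρ S M hM hRS hRM hε₁ hε₀ hreg₁ hreg₀ hU hV core) hw
  obtain ⟨hsa, htr, hchart, hA₀, hA₁, hslice⟩ := h6
  obtain ⟨h0, h1, h2, h3⟩ := package_rows_of_P1disp x ρ S M hM hw C hH hH' hCq hδR U ⟨hsa, hchart, hA₀, hA₁, hslice⟩
  exact ⟨u, A, h0, trace_chartPreimage_eq_zero _ htr (hCtrB A (fun b => lt_of_le_of_lt (hA₀ b) hδRt) htr), h1, h2, h3, hnear, hdp1⟩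

end Summit.QuantumFields.YangMills.Theorems.HalvingP1FlatPillarPackageBall

end
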